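import Summits.AtomisticToContinuum.BoseEinsteinCondensation.Theorems.DensityResponse.Negative.ModulatedOrbital

/-!
# Negative lemmas for crux `DensityResponse` (stmt-AtomisticToContinuum-9481), III: the modulated
# product state

Supports (does not close) stmt-AtomisticToContinuum-9481 (crux `DensityResponse`, route
`BECThomsonPrinciple`, rank 4).  Importable landed copy of the cdisprove seat's standing file
`Cruxes/DensityResponse/Disproof.lean` (generation 2), split by topic; `sorry`-free, standard axioms.
Nothing here asserts a `Theses` decl positively.

* §5 `prodState N hL : PeriodicTrialState N L`, `Φ(X) = ∏ᵢ φ_L(xᵢ)` (Tonelli on `[0,L)^{3N}` for the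
  normalisation), the pointwise kinetic bound `kineticDensity_prodState_le`
  (`|∇Φ|² ≤ 3N(2π/L)²|Φ|²`, `HasFDerivAt.finsetProd`) and the source
  `source_prodState` (`∫(Σᵢ 2cos θᵢ)|Φ|² = (8/9)N`, Fubini `integral_fin_nat_prod_eq_prod`).
-/

noncomputable section

open MeasureTheory Set Filter Metric
open scoped ENNReal NNReal BigOperators Classical

namespace Summit.AtomisticToContinuum.BoseEinsteinCondensation.Theorems.DensityResponse.Negative

open Literature.MathematicalPhysics.QuantumManyBody.BoseGas

/-! ## §5 The product trial state `Φ(X) = ∏ᵢ φ_L(xᵢ)` -/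

/-- The product wave function `∏ᵢ φ_L(xᵢ)`. [folklore] -/
def prodFun (N : ℕ) (L : ℝ) (X : Config N) : ℂ := ∏ i, orb L (X i)

/-- The product is `C¹`. [folklore] -/
theorem contDiff_prodFun (N : ℕ) (L : ℝ) : ContDiff ℝ 1 (prodFun N L) :=
  contDiff_prod fun i _ => ((contDiff_orb L).of_le le_top).comp
    (ContinuousLinearMap.proj (R := ℝ) (φ := fun _ => Space) i).contDiff

/-- The product is `L`-periodic in every particle and axis. [folklore] -/
theorem prodFun_periodic {N : ℕ} {L : ℝ} (hL : L ≠ 0) (X : Config N) (i : Fin N) (k : Fin 3) :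
    prodFun N L (X + Pi.single i (EuclideanSpace.single k L)) = prodFun N L X := by
  unfold prodFun
  refine Finset.prod_congr rfl fun j _ => ?_
  rw [Pi.add_apply]
  rcases eq_or_ne j i with rfl | hj
  · rw [Pi.single_eq_same, orb_periodic hL]
  · rw [Pi.single_eq_of_ne hj, add_zero]

/-- The product is Bose-symmetric. [folklore] -/
theorem prodFun_symm (N : ℕ) (L : ℝ) (σ : Equiv.Perm (Fin N)) (X : Config N) :
    prodFun N L (X ∘ σ) = prodFun N L X := by
  unfold prodFun
  exact Equiv.prod_comp σ (fun i => orb L (X i))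

/-- `|∏φ(xᵢ)|² = ∏|φ(xᵢ)|²` in `ℝ≥0∞`. [folklore] -/
theorem nnnorm_prodFun_sq (N : ℕ) (L : ℝ) (X : Config N) :
    (‖prodFun N L X‖₊ : ℝ≥0∞) ^ 2 = ∏ i, (‖orb L (X i)‖₊ : ℝ≥0∞) ^ 2 := by
  rw [prodFun, nnnorm_prod, ENNReal.ofNNReal_finsetProd, Finset.prod_pow]

/-- `|∏φ(xᵢ)|² = ∏|φ(xᵢ)|²`. [folklore] -/
theorem norm_prodFun_sq (N : ℕ) (L : ℝ) (X : Config N) :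
    ‖prodFun N L X‖ ^ 2 = ∏ i, ‖orb L (X i)‖ ^ 2 := by
  rw [prodFun, norm_prod, Finset.prod_pow]

/-- The product is normalised on `[0,L)^{3N}` (Tonelli). [folklore] -/
theorem lintegral_cellN_prodFun_sq (N : ℕ) {L : ℝ} (hL : 0 < L) :
    ∫⁻ X in cellN N L, (‖prodFun N L X‖₊ : ℝ≥0∞) ^ 2 = 1 := by
  simp_rw [nnnorm_prodFun_sq]
  rw [volume_restrict_cellN, Literature.Probability.Distributions.lintegral_fin_nat_prod_eq_prod
    _ (fun _ x => (‖orb L x‖₊ : ℝ≥0∞) ^ 2) (fun _ => measurable_orb_sq L)]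
  simp [lintegral_cell_orb_sq hL]

/-- **The modulated product state** `Φ_{N,L}(X) = ∏ᵢ c(1 + ½cos(2πx_{i,0}/L))` on the torus of
side `L` (smooth, periodic, Bose-symmetric, normalised). [folklore] -/
def prodState (N : ℕ) {L : ℝ} (hL : 0 < L) : PeriodicTrialState N L where
  ψ := prodFun N L
  contDiff := contDiff_prodFun N L
  periodic := prodFun_periodic hL.ne'
  symm := prodFun_symm N L
  norm_eq := lintegral_cellN_prodFun_sq N hL

/-- The wave function of `prodState`. [folklore] -/
theorem prodState_ψ (N : ℕ) {L : ℝ} (hL : 0 < L) : (prodState N hL).ψ = prodFun N L := rfl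

/-- The derivative of the product. [folklore] -/
theorem hasFDerivAt_prodFun (N : ℕ) (L : ℝ) (X : Config N) :
    HasFDerivAt (prodFun N L)
      (∑ i ∈ Finset.univ, (∏ j ∈ Finset.univ.erase i, orb L (X j)) •
        ((fderiv ℝ (orb L) (X i)).comp (ContinuousLinearMap.proj (R := ℝ) (φ := fun _ => Space) i))) X := by
  have hdiff : ∀ i : Fin N, HasFDerivAt (fun Y : Config N => orb L (Y i))
      ((fderiv ℝ (orb L) (X i)).comp (ContinuousLinearMap.proj (R := ℝ) (φ := fun _ => Space) i)) X := by
    intro i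
    have h1 : HasFDerivAt (orb L) (fderiv ℝ (orb L) (X i)) (X i) :=
      (hasFDerivAt_orb L (X i)).differentiableAt.hasFDerivAt
    exact h1.comp X (ContinuousLinearMap.proj (R := ℝ) (φ := fun _ => Space) i).hasFDerivAt
  exact HasFDerivAt.finsetProd (u := Finset.univ) (g := fun i (Y : Config N) => orb L (Y i)) (x := X)
    fun i _ => hdiff i

/-- `|∂_{i,k} Φ| ≤ (2π/L) |Φ|`. [folklore] -/
theorem norm_fderiv_prodFun_le (N : ℕ) {L : ℝ} (hL : 0 < L) (X : Config N) (i : Fin N) (k : Fin 3) :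
    ‖fderiv ℝ (prodFun N L) X (unitVec i k)‖ ≤ 2 * Real.pi / L * ‖prodFun N L X‖ := by
  rw [(hasFDerivAt_prodFun N L X).fderiv, FunLike.coe_sum, Finset.sum_apply,
    Finset.sum_eq_single i]
  · rw [smul_apply, ContinuousLinearMap.comp_apply, ContinuousLinearMap.proj_apply]
    simp only [unitVec, Pi.single_eq_same, smul_eq_mul, norm_mul]
    calc ‖∏ j ∈ Finset.univ.erase i, orb L (X j)‖ * ‖fderiv ℝ (orb L) (X i) (EuclideanSpace.single k 1)‖
        ≤ ‖∏ j ∈ Finset.univ.erase i, orb L (X j)‖ *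
            (2 * Real.pi / L * ‖EuclideanSpace.single k (1 : ℝ)‖ * ‖orb L (X i)‖) :=
          mul_le_mul_of_nonneg_left (norm_fderiv_orb_le hL _ _) (norm_nonneg _)
      _ = 2 * Real.pi / L * (‖∏ j ∈ Finset.univ.erase i, orb L (X j)‖ * ‖orb L (X i)‖) := by
          have hn1 : ‖(EuclideanSpace.single k (1 : ℝ) : Space)‖ = 1 := by simp
          rw [hn1]; ring
      _ = 2 * Real.pi / L * ‖prodFun N L X‖ := by
          rw [← norm_mul, Finset.prod_erase_mul _ _ (Finset.mem_univ i), prodFun]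
  · intro j _ hji
    rw [smul_apply, ContinuousLinearMap.comp_apply, ContinuousLinearMap.proj_apply]
    simp only [unitVec, Pi.single_eq_of_ne hji, map_zero, smul_zero]
  · intro h; exact absurd (Finset.mem_univ i) h

/-- `‖z‖₊² = ofReal ‖z‖²`. [folklore] -/
theorem ennnorm_sq_eq (z : ℂ) : (‖z‖₊ : ℝ≥0∞) ^ 2 = ENNReal.ofReal (‖z‖ ^ 2) := by
  rw [ENNReal.ofReal_pow (norm_nonneg _), ofReal_norm]; rfl

/-- **Pointwise kinetic bound**: `|∇Φ|² ≤ 3N (2π/L)² |Φ|²`. [folklore] -/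
theorem kineticDensity_prodState_le (N : ℕ) {L : ℝ} (hL : 0 < L) (X : Config N) :
    kineticDensity (prodState N hL).ψ X ≤
      ENNReal.ofReal (3 * N * (2 * Real.pi / L) ^ 2) * (‖(prodState N hL).ψ X‖₊ : ℝ≥0∞) ^ 2 := by
  rw [prodState_ψ]
  have hsq : ∀ (i : Fin N) (k : Fin 3),
      (‖fderiv ℝ (prodFun N L) X (unitVec i k)‖₊ : ℝ≥0∞) ^ 2 ≤
        ENNReal.ofReal ((2 * Real.pi / L) ^ 2) * (‖prodFun N L X‖₊ : ℝ≥0∞) ^ 2 := by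
    intro i k
    rw [ennnorm_sq_eq, ennnorm_sq_eq, ← ENNReal.ofReal_mul (sq_nonneg _), ← mul_pow]
    exact ENNReal.ofReal_le_ofReal (pow_le_pow_left₀ (norm_nonneg _) (norm_fderiv_prodFun_le N hL X i k) 2)
  calc kineticDensity (prodFun N L) X
      = ∑ i : Fin N, ∑ k : Fin 3, (‖fderiv ℝ (prodFun N L) X (unitVec i k)‖₊ : ℝ≥0∞) ^ 2 := rfl
    _ ≤ ∑ _i : Fin N, ∑ _k : Fin 3,
          ENNReal.ofReal ((2 * Real.pi / L) ^ 2) * (‖prodFun N L X‖₊ : ℝ≥0∞) ^ 2 :=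
        Finset.sum_le_sum fun i _ => Finset.sum_le_sum fun k _ => hsq i k
    _ = ENNReal.ofReal (3 * N * (2 * Real.pi / L) ^ 2) * (‖prodFun N L X‖₊ : ℝ≥0∞) ^ 2 := by
        rw [Finset.sum_const, Finset.sum_const, Finset.card_univ, Finset.card_univ, Fintype.card_fin,
          Fintype.card_fin, smul_smul, nsmul_eq_mul, ← mul_assoc]
        congr 1
        rw [show (3 : ℝ) * N * (2 * Real.pi / L) ^ 2 = ((N * 3 : ℕ) : ℝ) * (2 * Real.pi / L) ^ 2 by
          push_cast; ring, ENNReal.ofReal_mul (by positivity), ENNReal.ofReal_natCast]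

/-- **The source term of the product state**: `∫ (∑ᵢ 2cos θᵢ)|Φ|² = (8/9) N`. [folklore] -/
theorem source_prodState (N : ℕ) {L : ℝ} (hL : 0 < L) :
    ∫ X in cellN N L, (∑ i, 2 * Real.cos (θL L (X i))) * ‖(prodState N hL).ψ X‖ ^ 2 = N * (8 / 9) := by
  rw [prodState_ψ]
  -- one-body integrands
  let g : Fin N → Fin N → Space → ℝ := fun i j =>
    if j = i then fun x => 2 * Real.cos (θL L x) * ‖orb L x‖ ^ 2 else fun x => ‖orb L x‖ ^ 2
  have hcont : Continuous fun x => 2 * Real.cos (θL L x) * ‖orb L x‖ ^ 2 :=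
    (continuous_const.mul (Real.continuous_cos.comp (continuous_θL L))).mul ((continuous_orb L).norm.pow 2)
  have hg : ∀ i j, Integrable (g i j) ((volume : Measure Space).restrict (cell L)) := by
    intro i j
    by_cases h : j = i
    · simp only [g, if_pos h]
      refine integrableOn_cell_of_bound (g := fun x => 2 * Real.cos (θL L x) * ‖orb L x‖ ^ 2) hcont
        (M := 2 * (cL L * (3 / 2)) ^ 2) (fun x => ?_) L
      rw [Real.norm_eq_abs, abs_mul, abs_mul, abs_of_nonneg (sq_nonneg ‖orb L x‖), abs_two]
      have h1 : |Real.cos (θL L x)| ≤ 1 := Real.abs_cos_le_one _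
      have h2 : ‖orb L x‖ ^ 2 ≤ (cL L * (3 / 2)) ^ 2 :=
        pow_le_pow_left₀ (norm_nonneg _) (norm_orb_le hL x) 2
      calc 2 * |Real.cos (θL L x)| * ‖orb L x‖ ^ 2 ≤ 2 * 1 * (cL L * (3 / 2)) ^ 2 := by
            gcongr
        _ = 2 * (cL L * (3 / 2)) ^ 2 := by ring
    · simp only [g, if_neg h]
      exact integrableOn_cell_norm_orb_sq hL
  have hint : ∀ i j, ∫ x in cell L, g i j x = if j = i then 8 / 9 else 1 := by
    intro i j
    by_cases h : j = i
    · simp only [g, if_pos h]; exact integral_cell_two_cos_norm_orb_sq hL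
    · simp only [g, if_neg h]; exact integral_cell_norm_orb_sq hL
  -- pointwise: the integrand is `∑ᵢ ∏ⱼ g i j (X j)`
  have hpt : ∀ X : Config N, (∑ i, 2 * Real.cos (θL L (X i))) * ‖prodFun N L X‖ ^ 2 =
      ∑ i, ∏ j, g i j (X j) := by
    intro X
    rw [norm_prodFun_sq, Finset.sum_mul]
    refine Finset.sum_congr rfl fun i _ => ?_
    rw [← Finset.mul_prod_erase _ _ (Finset.mem_univ i), ← Finset.mul_prod_erase _ _ (Finset.mem_univ i)]
    simp only [g, if_true]
    rw [← mul_assoc]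
    congr 1
    exact Finset.prod_congr rfl fun j hj => by rw [if_neg (Finset.ne_of_mem_erase hj)]
  simp_rw [hpt]
  rw [integral_finsetSum _ fun i _ => ?_]
  · rw [volume_restrict_cellN]
    simp_rw [integral_fin_nat_prod_eq_prod, hint]
    rw [Finset.sum_congr rfl fun i _ => Finset.prod_ite_eq' Finset.univ i (fun _ => (8 / 9 : ℝ))]
    simp
  · rw [volume_restrict_cellN]
    exact Integrable.fin_nat_prod (fun j => hg i j)


end Summit.AtomisticToContinuum.BoseEinsteinCondensation.Theorems.DensityResponse.Negative

end
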